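import Summits.BirchSwinnertonDyer.Rank1Residual.Additive.ChiBranchInput
import HarnessLib

/-!
# X4 ∧ (semistable twist), `p ≡ 1 (mod 4)`: the EVEN `χ_p`-branch of Kato's divisibility for the big-image twist at `T = 0`, TYPED (cell `b2b-bsdres`, seat additive-p4, line V9b)

HONEST FRAMING (cell `b2b-bsdres`, run/shared/lean/b2b/bsd-rank1-residual/, verbatim in every
file): the goal of the cell is to DELETE the COMBINATION-SHAPED residual classes of the
Birch–Swinnerton-Dyer formula for ALL analytic-rank `≤ 1` elliptic curves over `ℚ` — "full BSD
formula for every rank `≤ 1` curve in class `C`" assembled STRICTLY from published theorems — so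
that the rank-`≤ 1` remainder becomes exactly the CONSTRUCTION-SHAPED classes, which are TYPED
(missing-input `Prop`s), NOT attempted. This is not "finishing BSD". The additive sub-cell (seats
additive-p1…p4) is a RESEARCH ROUTE on the construction-shaped classes X3/X4; no claim beyond the
stated classes; the label of X4 is UNCHANGED by this file.

Definitions only (one `def` + one unfolding lemma); NOTHING is asserted. Even-parity twin of
`ChiBranchInputBigImage.lean` (p204369, `p ≡ 3 (mod 4)`) and big-image twin of `ChiBranchInput.lean`
(p203015, X3, `E[p]` reducible): for `(E, p) ∈` X4 with `p ≡ 1 (mod 4)` (census primes `5, 13, 17`)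
whose twist `E♭ = E ⊗ χ_p` is semistable at `p` (cells (M), (G-ord, e = 2) with ordinary twist), the
divisibility input of line V9 is KATO's integral divisibility for `E♭` over `ℚ(ζ_{p^∞})`. The
PRINTED sources differ with the reduction type of `E♭` at `p` (referee nit
`chiBranch-Kato174-mult-shape-cite`, R106.10, corrected here — docstrings only, the `def` below is
byte-identical): (i) `E♭` GOOD ORDINARY at `p`: Kato, Astérisque 295, Thm. 17.4 (3) with 12.5 (4)
(`ρ_{E♭,p^∞}` with image `⊇ SL₂(ℤ_p)`, implied by surjectivity onto `GL₂(ℤ_p)` — at `p ≥ 5` by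
mod-`p` surjectivity, Serre) — Kato's §17 assumes `p ∤ N` (Prop. 17.1 (i), p. 272), so Thm. 17.4 is
a statement at primes of GOOD (ordinary) reduction only; (ii) `E♭` MULTIPLICATIVE at `p`: NOT Kato's
Thm. 17.4 but the divisibility over `ℚ(ζ_{p^∞})` as ATTRIBUTED to Kato by Wuthrich 2014, Thm. 3
(p. 383: "We formulate it here for the full cyclotomic `ℤ_p^×`-extension … This theorem was proven
by Kato in [10] in the case that the reduction is ordinary and the representation on the Tate module
was surjective", semistable `p`) with the first case of the proof of his Cor. 19 (p. 399) — the
cell's reading CITED-FACTS A32 / A105 / A108 (flag `Wu14-surj-attribution`). Either is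
taken in the EVEN `ω^{(p−1)/2}`-component and transported along the prime-to-`p` descent
`X(E/ℚ_∞) ≅ X(E♭/ℚ(μ_{p^∞}))^{(χ_p)}` [C] (Greenberg LNM 1716 §5; folklore, hence TYPED), value at
`T = 0` by Mazur–Tate–Teitelbaum §I.14 with the PLUS modular symbol:

* `ChiBranchLeadingTermBigImageAt W p` — for `W` additive `ℚ`-isomorphic to `V^{(p)}`, `V`
  globally minimal good ordinary or multiplicative at `p` with `ρ̄_{V,pⁿ}` onto for all `n`, `f` the
  newform of `V`, `κ/γ` cyclotomic, `D` a Selmer-dual datum of `W` over `ℚ_∞`, `ϖ · Ω_V = Ω⁺_f`: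
  `X(W/ℚ_∞)` is `Λ`-torsion and some `g ∈ char_Λ X(W/ℚ_∞)` has
  `g(0) = u · ϖ · ∑_{a mod p} (a/p)[a/p]⁺_f`, `u ∈ ℤ_p^×`.
Consumer: `Additive/X4RankZeroSemistableTwistEven.lean` (the `p ≡ 1 (mod 4)` X4 assembly: on the
semistable-twist rows it sharpens Kim 2026's published `ord_p #Ш ≤ ord_p #Ш_an + ord_p Tam(E)` to
`ord_p #Ш ≤ ord_p #Ш_an`, modulo this typed input).

References: Kato 2004 [Kato2004Asterisque] Thm. 17.4 (3), Prop. 17.1 (i), Thm. 12.5 (4), (12.5.2)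
(good ordinary `E♭`); Wuthrich 2014 [Wuthrich2014] Thm. 3 (p. 383, attribution to Kato; semistable `p`)
and Cor. 19 (p. 399, first case of the proof) (multiplicative `E♭`); Mazur–Tate–Teitelbaum 1986
[MazurTateTeitelbaum1986Invent] §I.14; Greenberg 1999 [GreenbergLNM1716] §5.
-/

noncomputable section

open scoped Classical MatrixGroups ModularForm

open CongruenceSubgroup WeierstrassCurve Literature.NumberTheory.EllipticCurves
  Literature.NumberTheory.EllipticCurves.ModularForms
  Literature.NumberTheory.EllipticCurves.Rank1Residual

namespace Summit.BirchSwinnertonDyer.Rank1Residual.Additive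

/-! ### The typed input, even branch, big image -/

/-- **[B'∘C] at the trivial character, EVEN branch (`p ≡ 1 (mod 4)`), BIG IMAGE, TYPED** — the
missing input of line V9b at `(E, p)` for `p ≡ 1 (mod 4)`. For the additive curve `E = W` at
`p ≡ 1 (mod 4)`: whenever `W` is `ℚ`-isomorphic to the quadratic twist by `p` of a globally minimal
`V` (`E♭`) that is good ordinary or multiplicative at `p` with `ρ̄_{V,pⁿ}` onto for every `n`, `f` is
the newform of `V`, `κ`/`γ` the cyclotomic `ℤ_p`-extension with a topological generator matching the
cyclotomic variable, `D` a Pontryagin-dual datum of `Sel_{p^∞}(W/ℚ_∞)` and `ϖ · Ω_V = Ω⁺_f`, then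
`X(W/ℚ_∞)` is `Λ`-torsion and SOME `g ∈ char_Λ X(W/ℚ_∞)` has
`g(0) = u · ϖ · ∑_{a mod p} (a/p)[a/p]⁺_f`, `u ∈ ℤ_p^×` — the `T = 0` specialisation of
"`char X(E/ℚ_∞) ∋` the `χ_p`-branch of Kato's `L_p(E♭)`-divisibility" (for `E♭` GOOD ORDINARY at
`p`: Kato 2004 Thm. 17.4 (3) / 12.5 (4) for `E♭` over `ℚ(ζ_{p^∞})` — Kato's §17 has `p ∤ N`,
Prop. 17.1 (i); for `E♭` MULTIPLICATIVE at `p`: the divisibility over `ℚ(ζ_{p^∞})` attributed to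
Kato by Wuthrich 2014 Thm. 3 (p. 383) with the first case of the proof of his Cor. 19 (p. 399),
reading A32/A105/A108, flag `Wu14-surj-attribution`; `ω^{(p−1)/2}`-component, transported along
`X(E/ℚ_∞) ≅ X(E♭/ℚ(μ_{p^∞}))^{(χ_p)}`; value at `T = 0` by Mazur–Tate–Teitelbaum §I.14). A predicate
on `(W, p)`; its universal closure is NOT asserted.
[cite: Kato2004Asterisque, Thm. 17.4 (3) (p. 273) and Prop. 17.1 (i) (p. 272) (good ordinary E♭; shape only; nothing asserted)]
[cite: Wuthrich2014, Thm. 3 (p. 383) and Cor. 19 (p. 399) (multiplicative E♭, attribution to Kato; shape only; nothing asserted)]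
[cite: MazurTateTeitelbaum1986Invent, §I.14 (shape only; nothing asserted)] -/
def ChiBranchLeadingTermBigImageAt (W : WeierstrassCurve ℚ) (p : ℕ) [Fact p.Prime] : Prop :=
  ∀ (V : WeierstrassCurve ℚ) [V.IsElliptic] [V.IsGloballyMinimal]
    {κ : ZpExtension ℚ p} {γ : Field.absoluteGaloisGroup ℚ} {N : ℕ} [NeZero N]
    {f : CuspForm (Gamma0 N) 2},
    p % 4 = 1 →
    (∃ C : VariableChange ℚ, C • V.quadraticTwist (p : ℚ) = W) →
    (GoodOrd V p ∨ Mult V p) → (∀ n : ℕ, V.HasSurjectiveModNGaloisRep (p ^ n : ℕ)) →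
    κ.IsCyclotomic → κ.IsTopGenerator γ → IsCyclotomicVariable p γ → IsNewformOf V f →
    ∀ (D : W.SelmerDualData κ γ) (ϖ : ℚ), (ϖ : ℝ) * V.realPeriodRat = plusPeriod f →
      D.IsTorsion ∧
      ∃ g ∈ D.charIdeal, ∃ u : ℤ_[p]ˣ,
        ((PowerSeries.constantCoeff g : ℤ_[p]) : ℚ_[p]) =
          ((u : ℤ_[p]) : ℚ_[p]) * (ϖ : ℚ_[p]) * (legendrePlusSymbolSum f p : ℚ_[p])

/-- Unfolding lemma for `ChiBranchLeadingTermBigImageAt`. -/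
theorem chiBranchLeadingTermBigImageAt_iff (W : WeierstrassCurve ℚ) (p : ℕ) [Fact p.Prime] :
    ChiBranchLeadingTermBigImageAt W p ↔
      ∀ (V : WeierstrassCurve ℚ) [V.IsElliptic] [V.IsGloballyMinimal]
        {κ : ZpExtension ℚ p} {γ : Field.absoluteGaloisGroup ℚ} {N : ℕ} [NeZero N]
        {f : CuspForm (Gamma0 N) 2},
        p % 4 = 1 →
        (∃ C : VariableChange ℚ, C • V.quadraticTwist (p : ℚ) = W) →
        (GoodOrd V p ∨ Mult V p) → (∀ n : ℕ, V.HasSurjectiveModNGaloisRep (p ^ n : ℕ)) →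
        κ.IsCyclotomic → κ.IsTopGenerator γ → IsCyclotomicVariable p γ → IsNewformOf V f →
        ∀ (D : W.SelmerDualData κ γ) (ϖ : ℚ), (ϖ : ℝ) * V.realPeriodRat = plusPeriod f →
          D.IsTorsion ∧
          ∃ g ∈ D.charIdeal, ∃ u : ℤ_[p]ˣ,
            ((PowerSeries.constantCoeff g : ℤ_[p]) : ℚ_[p]) =
              ((u : ℤ_[p]) : ℚ_[p]) * (ϖ : ℚ_[p]) * (legendrePlusSymbolSum f p : ℚ_[p]) :=
  Iff.rfl

end Summit.BirchSwinnertonDyer.Rank1Residual.Additive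

end
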